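import Summits.BirchSwinnertonDyer.BirchSwinnertonDyer.Theorems.InertBadSignedBranchesCccOneLawOnTypeIstarZeroOfLowerHalf
import Summits.BirchSwinnertonDyer.BirchSwinnertonDyer.Theorems.InertBadSignedBranchesCccOneLawOnTypeIstarZeroOfEtaGZPair
import Summits.BirchSwinnertonDyer.Rank1Residual.X12.InertCoreInstancesH
import Summits.BirchSwinnertonDyer.Rank1Residual.X12.CongruentNumberOddPart
import Summits.BirchSwinnertonDyer.Rank1Residual.X12.InertCoreEveryCurveCremona
import HarnessLib

/-!
# Route `InertBadSignedBranches` (rung K8) — BC5 / tribunal t3 WITNESS for the crux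
# `CccOneLawOnTypeIstarZero` (stmt-BirchSwinnertonDyer-19223) at the core pair `(16928e1, 23)`
# (= the congruent-number curve `E₂₃ : y² = x³ − 23²x`, class 𝒞_i, at its inert bad prime `23`)

Cell `bsd-cm`, seat `bsd-cm-inert` (g11); planner ORDER v5.3.14 «BC5 rung for `CccOneLawOnTypeIstarZero`
(one 𝒞-curve, one inert `I₀*` prime) — the tribunal's t3 witness for K8». HONEST READING: no member
instance of the crux (a statement about the `T¹`-coefficient of Kobayashi's `η`-branch `p`-adic
`L`-function of the good twin) is provable outright in the kernel today — that coefficient is a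
Literature object. What IS provable at the member `W = 16928e1 = [0, 0, 0, −529, 0]` (CM by `ℤ[i]`,
`j = 1728`, `N = 2⁵·23²`, `23 ≡ 3 (mod 4)` inert in `ℚ(i)`, Kodaira `I₀*` at `23`: the `(−23)`-twist of
`32a`, signed local type `(23, I₀*)` by `X12.CongruentNumber.hasSignedLocalType_of_dvd`):
**the crux instance `QuadraticBranchPAdicGrossZagierValuationAt 16928e1 23` FOLLOWS from the route's
OWN support items `PrintReadingsInert` (19226) and `PublishedFactsInert` (19227), the published facts
of the lane's route T-KR (Gross–Zagier and Kolyvagin over a Friedberg–Hoffstein field in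
Matar–Nekovář's irreducible form, GZK, modularity, the CM rank-zero triple for the twist, Cremona's
Manin table), and the lane's two certified per-pair data `r_an(W) = 1` and `ord₂₃ #Ш(W)_an = 0`**
(x1b record `X12.bsdp_23_c16928e1`, then this seat's converse
`CccOneLowerHalf.quadraticBranchPAdicGrossZagierValuationAt_of_bsdp_of_readings`). So at this member
the crux carries no content beyond the support items and a certified numerical datum; the (GZ_η-VAL)
valuation identity in print currency (`v₂₃(coeff₁ L⁻) = 2·ord₂₃ log_ω(P) + ord₂₃(L′(W,1)/(Ω_W·Reg W))`)
follows at the pair as a COROLLARY (g10's equivalence). ALSO (§3, per pair on the whole census range): with Cremona's theorem on the Manin constant for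
`N ≤ 130000` (x1b `X12.bsdp_iff_missingLowerBoundAt_of_classX12_of_not_cmRamified_of_conductorNorm_le`) resp.
Edixhoven–Deuring at `p ≥ 11` (`X12.bsdp_iff_missingLowerBoundAt_of_classX12_of_cmInert`), at every pair `(W, p)`
of the type: **C-cc-1 at `(W, p)` ⟺ `MissingLowerBoundAt W p`** (`ord_p #Ш_an ≤ ord_p #Ш`) modulo the support
items and published facts, and C-cc-1 at every such pair with certified `ord_p #Ш_an = 0`.
Nothing is asserted; no named fact is minted;
nothing closes; the class-level crux and O10 stay OPEN.
[cite: MatarNekovar2019, Thm. 0.3 and §0.11] [cite: AgasheRibetStein2006, Thm. 2.6 and appendix Thm. 5.2]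
[cite: Kobayashi2003, §4 (p. 8), Thm. 7.4 (p. 13)] [cite: Miller2011LMS, §1 and Def. 1.1]
[cite: SilvermanATAEC1994, IV.9.4 Step 6 and Table 4.1] [cite: Cremona1997, Table 1 (curve 16928e1)]
-/

set_option autoImplicit false
set_option linter.dupNamespace false

noncomputable section

open scoped Classical MatrixGroups ModularForm NumberField

open CongruenceSubgroup Field WeierstrassCurve NumberField
open Literature.NumberTheory.EllipticCurves
open Literature.NumberTheory.EllipticCurves.ModularForms
open Literature.NumberTheory.EllipticCurves.Kobayashi2003 hiding IsQuadraticBranchMinusLFunction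
open Literature.NumberTheory.EllipticCurves.Rank1Residual
open Literature.NumberTheory.EllipticCurves.Rank1Residual.Typed
open Literature.NumberTheory.EllipticCurves.AgasheRibetStein2006
open Literature.NumberTheory.GaloisRepresentations Literature.NumberTheory.GaloisCohomology
open Summit.BirchSwinnertonDyer.Rank1Residual
open Summit.BirchSwinnertonDyer.Rank1Residual.Additive
open Summit.BirchSwinnertonDyer.Rank1Residual.Additive.LocalLog
open Summit.BirchSwinnertonDyer.Rank1Residual.X12.O10

namespace Summit.BirchSwinnertonDyer.BirchSwinnertonDyer.Theorems.CccOneLowerHalf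

/-- `16928e1 = [0, 0, 0, −529, 0]` IS the congruent-number curve `E₂₃` (`−529 = −23²`). Bookkeeping.
[cite: Cremona1997, Table 1 (curve 16928e1)] -/
theorem c16928e1_eq_congruentNumberCurve :
    ∃ C : VariableChange ℚ, C • X12.Records.c16928e1 = congruentNumberCurve 23 :=
  ⟨1, by rw [one_smul]; simp only [X12.Records.c16928e1, congruentNumberCurve]; norm_num⟩

/-- **`16928e1` has signed local type `(23, I₀*)`**: CM by `ℤ[i]`, `23 ≡ 3 (mod 4)` inert in `ℚ(i)`,
bad at `23 ∣ 23` (squarefree), Kodaira `I₀*` at `23` — the O10-PS sub-cell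
(`X12.CongruentNumber.hasSignedLocalType_of_dvd`). [cite: SilvermanATAEC1994, IV.9.4 Step 6 and Table 4.1]
[cite: Cox2013, §5.B Prop. 5.16 and Cor. 5.17] -/
theorem hasSignedLocalType_c16928e1_twentyThree :
    HasSignedLocalType X12.Records.c16928e1 23 (.Istar 0) :=
  X12.CongruentNumber.hasSignedLocalType_of_dvd (W := X12.Records.c16928e1) (n := 23)
    (Nat.prime_iff.mp (by norm_num)).squarefree c16928e1_eq_congruentNumberCurve (by norm_num)
    (dvd_refl 23) (by norm_num)

/-- **t3 WITNESS (BC5 rung) for the crux `CccOneLawOnTypeIstarZero` at the core pair `(16928e1, 23)`.**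
The crux instance `Additive.QuadraticBranchPAdicGrossZagierValuationAt 16928e1 23` — for every good
`a₂₃ = 0` twin datum `(V, C, f, ϖ, L)` and every generator `P` of level `n`:
`coeff₁ L ≠ 0 ∧ v₂₃(coeff₁ L) = 2n + ord₂₃(#Ш_an·Tam/#tors²)` — FOLLOWS from: the route's support items
`PrintReadingsInert` (`h₅`) and `PublishedFactsInert` (`h₆`); the published facts of route T-KR
(`hGZ hKo hMN hFH hCM8` and Cremona's two sentences `h26 h52`, exactly the binders of x1b's record
`X12.bsdp_23_c16928e1`); the lane's certified data `r_an(W) = 1` (`hr`) and `#Ш(W)_an = q`,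
`ord₂₃ q = 0` (`hq hv`). Proof: T-KR gives `BSD(W, 23)`; the exact reading + Poitou–Tate give
`coeff₁ ≠ 0` and (C3_η); `BSD(W, 23)` + (C3_η) give the valuation equation
(`quadraticBranchPAdicGrossZagierValuationAt_of_bsdp_of_readings`); (C1_η) is needed on the twins, which
are CM with `23` inert (`hasCM_and_cmInert_of_twist`). CONDITIONAL on every displayed hypothesis;
nothing asserted; nothing closes. [cite: MatarNekovar2019, Thm. 0.3 and §0.11]
[cite: AgasheRibetStein2006, Thm. 2.6 and appendix Thm. 5.2] [cite: Kobayashi2003, §4 (p. 8), Thm. 7.4 (p. 13)]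
[cite: Miller2011LMS, §1 and Def. 1.1] -/
theorem cccOneLaw_c16928e1_twentyThree
    (h₅ : Summit.BirchSwinnertonDyer.BirchSwinnertonDyer.Theses.InertBadSignedBranches.PrintReadingsInert)
    (h₆ : Summit.BirchSwinnertonDyer.BirchSwinnertonDyer.Theses.InertBadSignedBranches.PublishedFactsInert)
    (hGZ : ∀ (N : ℕ) [NeZero N] (W : WeierstrassCurve ℚ) (K : Type) [Field K] [NumberField K],
      gross_zagier N W K)
    (hKo : ∀ (N : ℕ) [NeZero N] (W : WeierstrassCurve ℚ) (K : Type) [Field K] [NumberField K],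
      kolyvagin N W K)
    (hMN : ∀ (N : ℕ) [NeZero N] (W : WeierstrassCurve ℚ) (K : Type) [Field K] [NumberField K],
      MatarNekovar2019.thm03_padicValNat_card_sha_le_of_irreducible N W K)
    (hFH : friedbergHoffstein_exists_heegnerField_split_twist_ne_zero)
    (hCM8 : bsdTriple_of_hasCM_of_L_one_ne_zero)
    (h26 : cremona_abs_maninConstant_eq_one_of_level_le) (h52 : cremona_optimal_curveOne_x12Core)
    (hr : X12.Records.c16928e1.analyticRank = 1)
    {q : ℚ} (hq : shaAn X12.Records.c16928e1 = (q : ℂ)) (hv : padicValRat 23 q = 0) :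
    QuadraticBranchPAdicGrossZagierValuationAt X12.Records.c16928e1 23 := by
  obtain ⟨hmod, -, hGZK, hPT, hnf, -⟩ := h₆
  obtain ⟨hC1, hRd⟩ := h₅ 23 (by norm_num)
  have hT := hasSignedLocalType_c16928e1_twentyThree
  obtain ⟨hR2, h74x⟩ := hRd X12.Records.c16928e1 hT hr
  have hB : BSDp X12.Records.c16928e1 23 :=
    X12.bsdp_23_c16928e1 hGZ hKo hMN hGZK hmod hnf hFH hCM8 h26 h52 hr hq hv
  refine quadraticBranchPAdicGrossZagierValuationAt_of_bsdp_of_readings _ 23 hmod hGZK hPT hB hR2 h74x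
    fun V _ _ C hC hgood hap ↦ ?_
  obtain ⟨hCM, hin⟩ := hasCM_and_cmInert_of_twist _ 23 hT C hC
  exact hC1 V hCM hgood hin

/-- **COROLLARY at the pair: the (GZ_η-VAL) valuation identity in PRINT currency** — for every good
`a₂₃ = 0` twin datum of `16928e1`, every generator `P` of `W(ℚ)/tors` and every rational `q′` with
`L′(W,1)/(Ω_W·Reg W) = q′`: `coeff₁ L ≠ 0 ∧ v₂₃(coeff₁ L) = 2·ord₂₃ log_ω(P) + ord₂₃ q′` — from the
witness and g10's per-pair equivalence `EtaGZ.etaGZValuationAt_of_quadraticBranchPAdicGrossZagierValuationAt`.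
Same displayed hypotheses; nothing asserted. [cite: Kobayashi2003, §3 (3.5)–(3.7) (p. 7), §4 (p. 8)]
[cite: SilvermanAEC2009, IV.6.4 and VII.6.3] -/
theorem etaGZValuation_c16928e1_twentyThree
    (h₅ : Summit.BirchSwinnertonDyer.BirchSwinnertonDyer.Theses.InertBadSignedBranches.PrintReadingsInert)
    (h₆ : Summit.BirchSwinnertonDyer.BirchSwinnertonDyer.Theses.InertBadSignedBranches.PublishedFactsInert)
    (hGZ : ∀ (N : ℕ) [NeZero N] (W : WeierstrassCurve ℚ) (K : Type) [Field K] [NumberField K],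
      gross_zagier N W K)
    (hKo : ∀ (N : ℕ) [NeZero N] (W : WeierstrassCurve ℚ) (K : Type) [Field K] [NumberField K],
      kolyvagin N W K)
    (hMN : ∀ (N : ℕ) [NeZero N] (W : WeierstrassCurve ℚ) (K : Type) [Field K] [NumberField K],
      MatarNekovar2019.thm03_padicValNat_card_sha_le_of_irreducible N W K)
    (hFH : friedbergHoffstein_exists_heegnerField_split_twist_ne_zero)
    (hCM8 : bsdTriple_of_hasCM_of_L_one_ne_zero)
    (h26 : cremona_abs_maninConstant_eq_one_of_level_le) (h52 : cremona_optimal_curveOne_x12Core)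
    (hr : X12.Records.c16928e1.analyticRank = 1)
    {q : ℚ} (hq : shaAn X12.Records.c16928e1 = (q : ℂ)) (hv : padicValRat 23 q = 0)
    (V : WeierstrassCurve ℚ) [V.IsElliptic] [V.IsGloballyMinimal] (C : VariableChange ℚ)
    {N : ℕ} [NeZero N] {f : CuspForm (Gamma0 N) 2}
    (hCV : C • (X12.Records.c16928e1).quadraticTwist ((-1) ^ (23 / 2) * (23 : ℕ)) = V)
    (hgood : V.HasGoodReductionAtPrime 23) (hap : V.frobeniusTrace 23 = 0) (hf : IsNewformOf V f)
    (ϖ : ℚ) (hϖ : if Even (23 / 2) then (ϖ : ℝ) * V.realPeriodRat = plusPeriod f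
        else (ϖ : ℝ) * V.imaginaryPeriodRat = minusPeriod f)
    (L : IwasawaAlgebra 23) (hL : IsQuadraticBranchMinusLFunction f 23 ϖ L)
    (P : (X12.Records.c16928e1).toAffine.Point) (hP : ¬ IsOfFinAddOrder P)
    (hgen : ∀ R : (X12.Records.c16928e1).toAffine.Point,
      ∃ (k : ℤ) (T : (X12.Records.c16928e1).toAffine.Point), IsOfFinAddOrder T ∧ R = k • P + T)
    (q' : ℚ) (hq' : (X12.Records.c16928e1).leadingLCoeff /
      (((X12.Records.c16928e1).realPeriodRat * (X12.Records.c16928e1).regulator : ℝ) : ℂ) = (q' : ℂ)) :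
    PowerSeries.coeff 1 L ≠ 0 ∧
      ((PowerSeries.coeff 1 L : ℤ_[23]) : ℚ_[23]).valuation =
        2 * (padicLog ((X12.Records.c16928e1).baseChange ℚ_[23]) ((X12.Records.c16928e1).toPadicPoint 23 P)).valuation +
          padicValRat 23 q' :=
  EtaGZ.etaGZValuationAt_of_quadraticBranchPAdicGrossZagierValuationAt X12.Records.c16928e1 23 (by norm_num)
    hasSignedLocalType_c16928e1_twentyThree hr
    (cccOneLaw_c16928e1_twentyThree h₅ h₆ hGZ hKo hMN hFH hCM8 h26 h52 hr hq hv) V C hCV hgood hap hf ϖ hϖ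
    L hL P hP hgen q' hq'


/-! ## §3 Per pair on the census range: C-cc-1 at `(W, p)` ⟺ the lower half at `(W, p)` -/

variable (W : WeierstrassCurve ℚ) [W.IsElliptic] [W.IsGloballyMinimal] (p : ℕ) [hp : Fact p.Prime]

/-- **Per pair, `p ≥ 5`, conductor `≤ 130000`: C-cc-1 at `(W, p)` ⟺ `MissingLowerBoundAt W p`**
(`ord_p #Ш(W)_an ≤ ord_p #Ш(W)`), for `W` of signed type `(p, I₀*)` with `r_an(W) = 1`, modulo the route's
support items `h₅ h₆` and the published facts of x1b's Cremona-range every-curve upper half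
(`X12.bsdp_iff_missingLowerBoundAt_of_classX12_of_not_cmRamified_of_conductorNorm_le`: the Manin datum is
Cremona's theorem `|c| = 1` for optimal curves of conductor `≤ 130000`). Forward: class node of record ⟹
`BSD(W, p)` ⟹ lower half; backward: lower + upper ⟹ `BSD(W, p)` ⟹ C-cc-1 (`…_of_bsdp_of_readings`).
CONDITIONAL; nothing booked. [cite: AgasheRibetStein2006, Thm. 2.6 and appendix Thm. 5.2]
[cite: MatarNekovar2019, Thm. 0.3 and §0.11] [cite: Miller2011LMS, §1 and Def. 1.1] -/
theorem quadraticBranchPAdicGrossZagierValuationAt_iff_missingLowerBoundAt_of_conductorNorm_le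
    (h₅ : Summit.BirchSwinnertonDyer.BirchSwinnertonDyer.Theses.InertBadSignedBranches.PrintReadingsInert)
    (h₆ : Summit.BirchSwinnertonDyer.BirchSwinnertonDyer.Theses.InertBadSignedBranches.PublishedFactsInert)
    (hGZ : ∀ (N : ℕ) [NeZero N] (W : WeierstrassCurve ℚ) (K : Type) [Field K] [NumberField K],
      gross_zagier N W K)
    (hKo : ∀ (N : ℕ) [NeZero N] (W : WeierstrassCurve ℚ) (K : Type) [Field K] [NumberField K],
      kolyvagin N W K)
    (hMN : ∀ (N : ℕ) [NeZero N] (W : WeierstrassCurve ℚ) (K : Type) [Field K] [NumberField K],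
      MatarNekovar2019.thm03_padicValNat_card_sha_le_of_irreducible N W K)
    (hFH : friedbergHoffstein_exists_heegnerField_split_twist_ne_zero)
    (hCM8 : bsdTriple_of_hasCM_of_L_one_ne_zero)
    (h26 : cremona_abs_maninConstant_eq_one_of_level_le) (hCassels : bsdRHS_eq_of_isIsogenous)
    (hp5 : 5 ≤ p) (hT : HasSignedLocalType W p (.Istar 0)) (hr : W.analyticRank = 1)
    (hN : W.conductorNorm ℤ ≤ 130000) :
    QuadraticBranchPAdicGrossZagierValuationAt W p ↔ MissingLowerBoundAt W p := by
  obtain ⟨hmod, hGZ', hGZK, hPT, hnf, hM⟩ := h₆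
  obtain ⟨hC1, hRd⟩ := h₅ p hp5
  obtain ⟨hR2, h74x⟩ := hRd W hT hr
  have key := X12.bsdp_iff_missingLowerBoundAt_of_classX12_of_not_cmRamified_of_conductorNorm_le hGZ hKo
    hMN hGZK hmod hnf hFH hCM8 h26 hCassels W p (classX12_of_hasSignedLocalType W p hT hr) hp5 hT.2.1.1 hN
  refine ⟨fun h2 ↦ key.mp ?_, fun hlow ↦ ?_⟩
  · exact bsdp_of_hasSignedLocalType_IstarZero_of_valuation_of_readings hmod hGZ' hGZK hPT hnf
      (periodRatio_of_mazur p hM hp5) hC1 W h2 hR2 h74x hT hr hp5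
  · refine quadraticBranchPAdicGrossZagierValuationAt_of_bsdp_of_readings W p hmod hGZK hPT (key.mpr hlow)
      hR2 h74x fun V _ _ C hC hgood hap ↦ ?_
    obtain ⟨hCM, hin⟩ := hasCM_and_cmInert_of_twist W p hT C hC
    exact hC1 V hCM hgood hin

/-- **Per pair, `p ≥ 11`, ANY conductor: C-cc-1 at `(W, p)` ⟺ `MissingLowerBoundAt W p`**, for `W` of
signed type `(p, I₀*)` with `r_an(W) = 1`, modulo `h₅ h₆` and the eleven published facts of x1b's
every-curve upper half (`X12.bsdp_iff_missingLowerBoundAt_of_classX12_of_cmInert`). CONDITIONAL; nothing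
booked. [cite: EdixhovenManin1991, Thm. 3] [cite: MatarNekovar2019, Thm. 0.3 and §0.11]
[cite: Miller2011LMS, §1 and Def. 1.1] -/
theorem quadraticBranchPAdicGrossZagierValuationAt_iff_missingLowerBoundAt_of_seven_lt
    (h₅ : Summit.BirchSwinnertonDyer.BirchSwinnertonDyer.Theses.InertBadSignedBranches.PrintReadingsInert)
    (h₆ : Summit.BirchSwinnertonDyer.BirchSwinnertonDyer.Theses.InertBadSignedBranches.PublishedFactsInert)
    (hGZ : ∀ (N : ℕ) [NeZero N] (W : WeierstrassCurve ℚ) (K : Type) [Field K] [NumberField K],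
      gross_zagier N W K)
    (hKo : ∀ (N : ℕ) [NeZero N] (W : WeierstrassCurve ℚ) (K : Type) [Field K] [NumberField K],
      kolyvagin N W K)
    (hMN : ∀ (N : ℕ) [NeZero N] (W : WeierstrassCurve ℚ) (K : Type) [Field K] [NumberField K],
      MatarNekovar2019.thm03_padicValNat_card_sha_le_of_irreducible N W K)
    (hFH : friedbergHoffstein_exists_heegnerField_split_twist_ne_zero)
    (hCM8 : bsdTriple_of_hasCM_of_L_one_ne_zero)
    (hEdx : edixhoven_not_dvd_maninConstant_of_not_potentiallyGoodOrdinary)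
    (hDeu : deuring_not_hasUnitRootAt_of_hasCM_of_not_cmSplit) (hCassels : bsdRHS_eq_of_isIsogenous)
    (hp7 : 7 < p) (hT : HasSignedLocalType W p (.Istar 0)) (hr : W.analyticRank = 1) :
    QuadraticBranchPAdicGrossZagierValuationAt W p ↔ MissingLowerBoundAt W p := by
  have hp5 : 5 ≤ p := by omega
  obtain ⟨hmod, hGZ', hGZK, hPT, hnf, hM⟩ := h₆
  obtain ⟨hC1, hRd⟩ := h₅ p hp5
  obtain ⟨hR2, h74x⟩ := hRd W hT hr
  have key := X12.bsdp_iff_missingLowerBoundAt_of_classX12_of_cmInert hGZ hKo hMN hGZK hmod hnf hFH hCM8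
    hEdx hDeu hCassels W p (classX12_of_hasSignedLocalType W p hT hr) hp7 hT.2.1.1 hT.2.1.2
  refine ⟨fun h2 ↦ key.mp ?_, fun hlow ↦ ?_⟩
  · exact bsdp_of_hasSignedLocalType_IstarZero_of_valuation_of_readings hmod hGZ' hGZK hPT hnf
      (periodRatio_of_mazur p hM hp5) hC1 W h2 hR2 h74x hT hr hp5
  · refine quadraticBranchPAdicGrossZagierValuationAt_of_bsdp_of_readings W p hmod hGZK hPT (key.mpr hlow)
      hR2 h74x fun V _ _ C hC hgood hap ↦ ?_
    obtain ⟨hCM, hin⟩ := hasCM_and_cmInert_of_twist W p hT C hC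
    exact hC1 V hCM hgood hin

/-- **Per pair, `p ≥ 5`, conductor `≤ 130000`, `ord_p #Ш(W)_an = 0` certified: C-cc-1 at `(W, p)`**
(route T-KR on the Cremona range, then `…_of_bsdp_of_readings`) — covers every O10-PS census pair of
conductor `≤ 130000` on which the lane certifies `r_an = 1` and `ord_p #Ш_an = 0`. PER PAIR; CONDITIONAL;
nothing booked. [cite: AgasheRibetStein2006, Thm. 2.6 and appendix Thm. 5.2]
[cite: MatarNekovar2019, Thm. 0.3 and §0.11] [cite: Miller2011LMS, §1 and Def. 1.1] -/
theorem quadraticBranchPAdicGrossZagierValuationAt_of_shaAn_unit_of_conductorNorm_le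
    (h₅ : Summit.BirchSwinnertonDyer.BirchSwinnertonDyer.Theses.InertBadSignedBranches.PrintReadingsInert)
    (h₆ : Summit.BirchSwinnertonDyer.BirchSwinnertonDyer.Theses.InertBadSignedBranches.PublishedFactsInert)
    (hGZ : ∀ (N : ℕ) [NeZero N] (W : WeierstrassCurve ℚ) (K : Type) [Field K] [NumberField K],
      gross_zagier N W K)
    (hKo : ∀ (N : ℕ) [NeZero N] (W : WeierstrassCurve ℚ) (K : Type) [Field K] [NumberField K],
      kolyvagin N W K)
    (hMN : ∀ (N : ℕ) [NeZero N] (W : WeierstrassCurve ℚ) (K : Type) [Field K] [NumberField K],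
      MatarNekovar2019.thm03_padicValNat_card_sha_le_of_irreducible N W K)
    (hFH : friedbergHoffstein_exists_heegnerField_split_twist_ne_zero)
    (hCM8 : bsdTriple_of_hasCM_of_L_one_ne_zero)
    (h26 : cremona_abs_maninConstant_eq_one_of_level_le) (hCassels : bsdRHS_eq_of_isIsogenous)
    (hp5 : 5 ≤ p) (hT : HasSignedLocalType W p (.Istar 0)) (hr : W.analyticRank = 1)
    (hN : W.conductorNorm ℤ ≤ 130000) {q : ℚ} (hq : shaAn W = (q : ℂ)) (hv : padicValRat p q = 0) :
    QuadraticBranchPAdicGrossZagierValuationAt W p :=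
  (quadraticBranchPAdicGrossZagierValuationAt_iff_missingLowerBoundAt_of_conductorNorm_le W p h₅ h₆ hGZ hKo
    hMN hFH hCM8 h26 hCassels hp5 hT hr hN).mpr (X12.missingLowerBoundAt_of_shaAn_unit hq hv)

end Summit.BirchSwinnertonDyer.BirchSwinnertonDyer.Theorems.CccOneLowerHalf

end
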